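import Summits.HodgeConjecture.CorCM.TwoGroupInvertedCyclicEightTable
import Summits.HodgeConjecture.CorCM.GaloisTwentyFourC3SemidirectC8Degenerate
import Summits.HodgeConjecture.CorCM.TwoGroupQuaternionRelations
import Summits.HodgeConjecture.CorCM.GaloisTwoPowerDescentStructure
import HarnessLib

/-!
# Degree `32`, an element of order `8` inverted by `x`: the leaves `D₁₆ × C₂`, `C₈ ⋊₋₁ C₄` (BAD) and `Q₁₆ × C₂` (structured)

COR-CM (cell `pub-hodgecm2`), binder seat b04 (gen 36), count-neutral own lane «Galois-CM-type classification».  KERNEL ONLY: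
theorems; no definition, no named fact, no `sorry`.  `HC_CM` is neither used nor claimed.  ORDER-`32` BASE programme (A7-JUNCTION
gen-36 addendum), B2 world: `Gal(K/ℚ) ⊇ A = ⟨r⟩ × ⟨t⟩ ≅ C₈ × C₂` of index `2` (`t` a central involution, complex conjugation `c = r⁴`)
and `x ∉ A` with `x r x⁻¹ = r⁻¹`, `x² = rᵃ tᵇ`.  Through the table model of `CorCM/TwoGroupInvertedCyclicEightTable` on
`ℤ/8 × 𝔽₂ × 𝔽₂`:

* `exists_simple_degenerate_of_inverted_table` — certificate format (gen 20's balanced sets) for `c₀ = (4,0,0)`.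
* **`exists_simple_degenerate_inverting_d16c2`** (`x² = 1`: `Gal ≅ D₁₆ × C₂`, census row #17 with `c = r⁴`),
  **`…_inverting_sq_t`** (`x² = t`) and **`…_inverting_sq_r4t`** (`x² = r⁴t`) (both `Gal ≅ C₈ ⋊₋₁ C₄`, census row #45 with
  `c = r⁴`): a simple DEGENERATE CM abelian `16`-fold (primitive CM sets of rank `13 < 17`, balanced sets of size `4`, `decide`).
* **`struct_of_inverting_sq_r4`** (`x² = r⁴`: `Gal = Q₁₆ × ⟨t⟩`): STRUCT — `H = {g : (e g)₂ = 0} ≃ Q₁₆` (gen 34's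
  `nonempty_mulEquiv_quaternionGroup_of_relations`), `E = ⟨t⟩`, `H.IsComplement' E`, `c ∈ H`.
These are exactly the leaves of the B2 case analysis that survive the quotient test `K^⟨ct⟩` (`CorCM/GaloisThirtyTwoOrderEightBranch`).

## References

* [Shimura1998] G. Shimura, *Abelian Varieties with Complex Multiplication and Modular Functions*, §6.2 Thm. 3, §8.2 Prop. 26.
* [Gordon1999HodgeAVSurvey] B. B. Gordon, *A survey of the Hodge conjecture for abelian varieties*, Thm. 6.4, §9.3.
* [Rotman1995] J. J. Rotman, *An Introduction to the Theory of Groups*, 4th ed., GTM 148, Thm. 5.46.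
-/

noncomputable section

open CategoryTheory CategoryTheory.Limits NumberField
open scoped BigOperators

namespace Summit.HodgeConjecture.CorCM.GaloisModels

open Literature.NumberTheory.ComplexMultiplication
open Literature.AlgebraicGeometry.Motives (AbelianVariety CMType)
open Literature.AlgebraicGeometry.HodgeTheory
open Literature.AlgebraicGeometry.ComplexMultiplication (IsCMTypeRealisation)
open Literature.AlgebraicGeometry.Pohlmann1968
open Literature.Barriers.HodgeConjecture (divisorClassesSpan)
open Summit.HodgeConjecture.CorCM.GaloisRank
open Summit.HodgeConjecture.CorCM.GaloisModels.CyclicEight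
open Summit.HodgeConjecture.CorCM.GaloisModels.UniqueInvolution (nonempty_mulEquiv_quaternionGroup_of_relations)

variable {K : Type} [Field K] [NumberField K] [IsCMField K] [IsGalois ℚ K]

/-! ## §1 The BAD leaves -/

/-- **Certificate format**: `[K:ℚ] = 32`, `r, t, x ∈ Gal(K/ℚ)` with `orderOf r = 8`, `t` an involution `∉ ⟨r⟩` commuting with `r`,
`x r = r⁻¹ x`, `x t = t x`, `x² = rᵃ tᵇ`, `rⁱ tʲ x ≠ 1`, complex conjugation `c = r⁴`; `mul` the law of
`CorCM/TwoGroupInvertedCyclicEightTable` with its unit and left-inverse identities; a CM set `T₀` for `c₀ = (4,0,0)` with trivial left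
stabiliser and a balanced `D` with `c₀ D ≠ D`.  Then `K` carries a simple DEGENERATE CM abelian `16`-fold with an exceptional Hodge
class on a power. [cite: Shimura1998, §6.2 Thm. 3 and §8.2 Prop. 26] [cite: Gordon1999HodgeAVSurvey, Thm. 6.4 and §9.3] -/
theorem exists_simple_degenerate_of_inverted_table (hdeg : Module.finrank ℚ K = 32) (r t x : K ≃ₐ[ℚ] K)
    (hr : orderOf r = 8) (htt : t * t = 1) (htr : t ∉ Subgroup.zpowers r) (hrt : r * t = t * r)
    (hxr : x * r = r⁻¹ * x) (hxt : x * t = t * x) (hxA : ∀ i j : ℕ, r ^ i * t ^ j * x ≠ 1)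
    (hc : (IsCMField.complexConj K).restrictScalars ℚ = r ^ 4) (a : ZMod 8) (b : ZMod 2)
    (hxx : x * x = r ^ a.val * t ^ b.val)
    (mul : ZMod 8 × ZMod 2 × ZMod 2 → ZMod 8 × ZMod 2 × ZMod 2 → ZMod 8 × ZMod 2 × ZMod 2)
    (hm : ∀ p q : ZMod 8 × ZMod 2 × ZMod 2, mul p q =
      (p.1 + (if p.2.2 = 0 then q.1 else 7 * q.1) + (if p.2.2 = 1 ∧ q.2.2 = 1 then a else 0),
        p.2.1 + q.2.1 + (if p.2.2 = 1 ∧ q.2.2 = 1 then b else 0), p.2.2 + q.2.2))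
    (ho : ∀ p : ZMod 8 × ZMod 2 × ZMod 2, mul p (0, 0, 0) = p)
    (hlinv : ∀ p q : ZMod 8 × ZMod 2 × ZMod 2,
      mul (if p.2.2 = 0 then (-p.1, p.2.1, 0) else (p.1 + a, p.2.1 + b, 1)) (mul p q) = q)
    (T₀ : Finset (ZMod 8 × ZMod 2 × ZMod 2))
    (hcm : ∀ z : ZMod 8 × ZMod 2 × ZMod 2, z ∈ T₀ ↔ mul (4, 0, 0) z ∉ T₀)
    (hprim : ∀ v : ZMod 8 × ZMod 2 × ZMod 2, v ≠ (0, 0, 0) → ∃ w : ZMod 8 × ZMod 2 × ZMod 2, ¬ (w ∈ T₀ ↔ mul v w ∈ T₀))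
    (D : Finset (ZMod 8 × ZMod 2 × ZMod 2))
    (hbal : ∀ g : ZMod 8 × ZMod 2 × ZMod 2, 2 * (D.filter fun z => mul z g ∈ T₀).card = D.card)
    (hmov : ∃ z ∈ D, mul (4, 0, 0) z ∉ D) :
    ∃ (Φ : CMType K) (φ : K →+* ℂ) (X : AbelianVariety ℂ) (ι : 𝓞 K →+* End X)
      (ϑ : K →+* Module.End ℂ (complexBetti X.X 1)),
      IsPrimitive (ℂ ≃+* ℂ) Φ.1 φ ∧ ¬ IsNondegenerate Φ ∧ IsCMTypeRealisation Φ X ι ϑ ∧ X.IsSimple ∧ X.dim = 16 ∧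
      ∃ m p : ℕ, ∃ z : complexBetti (⨁ fun _ : Fin m => X).X (2 * p), IsRationalClass z ∧
        IsOfHodgeType (⨁ fun _ : Fin m => X).dim (⨁ fun _ : Fin m => X).X (2 * p) p p z ∧
        z ∉ divisorClassesSpan (⨁ fun _ : Fin m => X).X (⨁ fun _ : Fin m => X).dim p := by
  classical
  have hcard : Nat.card (K ≃ₐ[ℚ] K) = 32 := by
    rw [Nat.card_eq_fintype_card, card_model_eq_finrank (MulEquiv.refl (K ≃ₐ[ℚ] K)), hdeg]
  obtain ⟨e, he, -, -, -, he1, hef⟩ := exists_table_inverted hcard hr htt htr hrt hxr hxt a b hxx hxA mul hm ho hlinv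
  have hec : e ((IsCMField.complexConj K).restrictScalars ℚ) = (4, 0, 0) := by
    rw [hc, ← hef (4, 0, 0)]
    simp only [show ((4 : ZMod 8)).val = 4 from rfl, show ((0 : ZMod 2)).val = 0 from rfl, pow_zero, mul_one]
  have h := exists_simple_degenerate_of_table_balanced mul e he (4, 0, 0) hec (0, 0, 0) he1 T₀ hcm hprim D hbal hmov
  have h16 : Fintype.card (ZMod 8 × ZMod 2 × ZMod 2) / 2 = 16 := by simp [Fintype.card_prod, ZMod.card]
  rwa [h16] at h

set_option synthInstance.maxSize 4096 in
/-- **`x² = 1`** (`Gal(K/ℚ) ≅ D₁₆ × C₂`, `c = r⁴`: census row #17, first column): a simple DEGENERATE CM abelian `16`-fold (primitive CM set of rank `13 < 17`, balanced set of size `4`, by `decide`). [cite: Shimura1998, §6.2 Thm. 3 and §8.2 Prop. 26] [cite: Gordon1999HodgeAVSurvey, Thm. 6.4 and §9.3] -/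
theorem exists_simple_degenerate_inverting_d16c2 (hdeg : Module.finrank ℚ K = 32) (r t x : K ≃ₐ[ℚ] K)
    (hr : orderOf r = 8) (htt : t * t = 1) (htr : t ∉ Subgroup.zpowers r) (hrt : r * t = t * r)
    (hxr : x * r = r⁻¹ * x) (hxt : x * t = t * x) (hxA : ∀ i j : ℕ, r ^ i * t ^ j * x ≠ 1)
    (hc : (IsCMField.complexConj K).restrictScalars ℚ = r ^ 4)
    (hxx : x * x = 1) :
    ∃ (Φ : CMType K) (φ : K →+* ℂ) (X : AbelianVariety ℂ) (ι : 𝓞 K →+* End X)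
      (ϑ : K →+* Module.End ℂ (complexBetti X.X 1)),
      IsPrimitive (ℂ ≃+* ℂ) Φ.1 φ ∧ ¬ IsNondegenerate Φ ∧ IsCMTypeRealisation Φ X ι ϑ ∧ X.IsSimple ∧ X.dim = 16 ∧
      ∃ m p : ℕ, ∃ z : complexBetti (⨁ fun _ : Fin m => X).X (2 * p), IsRationalClass z ∧
        IsOfHodgeType (⨁ fun _ : Fin m => X).dim (⨁ fun _ : Fin m => X).X (2 * p) p p z ∧
        z ∉ divisorClassesSpan (⨁ fun _ : Fin m => X).X (⨁ fun _ : Fin m => X).dim p :=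
  exists_simple_degenerate_of_inverted_table hdeg r t x hr htt htr hrt hxr hxt hxA hc 0 0
    (by rw [show ((0 : ZMod 8)).val = 0 from rfl, show ((0 : ZMod 2)).val = 0 from rfl, pow_zero, pow_zero, mul_one]; exact hxx)
    (fun p q : ZMod 8 × ZMod 2 × ZMod 2 =>
      (p.1 + (if p.2.2 = 0 then q.1 else 7 * q.1) + (if p.2.2 = 1 ∧ q.2.2 = 1 then 0 else 0),
        p.2.1 + q.2.1 + (if p.2.2 = 1 ∧ q.2.2 = 1 then 0 else 0), p.2.2 + q.2.2))
    (fun _ _ => rfl) (by decide) (by decide)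
    {(0, 0, 0), (0, 1, 1), (1, 0, 0), (1, 1, 1), (2, 0, 0), (2, 0, 1), (2, 1, 0), (2, 1, 1), (3, 0, 0), (3, 0, 1),
    (4, 0, 1), (4, 1, 0), (5, 0, 1), (5, 1, 0), (7, 1, 0), (7, 1, 1)}
    (by decide) (by decide)
    {(0, 0, 0), (0, 0, 1), (0, 1, 0), (0, 1, 1)}
    (by decide) (by decide)

set_option synthInstance.maxSize 4096 in
/-- **`x² = t`** (`Gal(K/ℚ) ≅ C₈ ⋊₋₁ C₄ = ⟨r⟩ ⋊ ⟨x⟩`, `c = r⁴`: census row #45, first column): a simple DEGENERATE CM abelian `16`-fold (primitive CM set of rank `13 < 17`, balanced set of size `4`, by `decide`). [cite: Shimura1998, §6.2 Thm. 3 and §8.2 Prop. 26] [cite: Gordon1999HodgeAVSurvey, Thm. 6.4 and §9.3] -/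
theorem exists_simple_degenerate_inverting_sq_t (hdeg : Module.finrank ℚ K = 32) (r t x : K ≃ₐ[ℚ] K)
    (hr : orderOf r = 8) (htt : t * t = 1) (htr : t ∉ Subgroup.zpowers r) (hrt : r * t = t * r)
    (hxr : x * r = r⁻¹ * x) (hxt : x * t = t * x) (hxA : ∀ i j : ℕ, r ^ i * t ^ j * x ≠ 1)
    (hc : (IsCMField.complexConj K).restrictScalars ℚ = r ^ 4)
    (hxx : x * x = t) :
    ∃ (Φ : CMType K) (φ : K →+* ℂ) (X : AbelianVariety ℂ) (ι : 𝓞 K →+* End X)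
      (ϑ : K →+* Module.End ℂ (complexBetti X.X 1)),
      IsPrimitive (ℂ ≃+* ℂ) Φ.1 φ ∧ ¬ IsNondegenerate Φ ∧ IsCMTypeRealisation Φ X ι ϑ ∧ X.IsSimple ∧ X.dim = 16 ∧
      ∃ m p : ℕ, ∃ z : complexBetti (⨁ fun _ : Fin m => X).X (2 * p), IsRationalClass z ∧
        IsOfHodgeType (⨁ fun _ : Fin m => X).dim (⨁ fun _ : Fin m => X).X (2 * p) p p z ∧
        z ∉ divisorClassesSpan (⨁ fun _ : Fin m => X).X (⨁ fun _ : Fin m => X).dim p :=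
  exists_simple_degenerate_of_inverted_table hdeg r t x hr htt htr hrt hxr hxt hxA hc 0 1
    (by rw [show ((0 : ZMod 8)).val = 0 from rfl, show ((1 : ZMod 2)).val = 1 from rfl, pow_zero, pow_one, one_mul]; exact hxx)
    (fun p q : ZMod 8 × ZMod 2 × ZMod 2 =>
      (p.1 + (if p.2.2 = 0 then q.1 else 7 * q.1) + (if p.2.2 = 1 ∧ q.2.2 = 1 then 0 else 0),
        p.2.1 + q.2.1 + (if p.2.2 = 1 ∧ q.2.2 = 1 then 1 else 0), p.2.2 + q.2.2))
    (fun _ _ => rfl) (by decide) (by decide)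
    {(0, 0, 0), (0, 0, 1), (1, 0, 0), (1, 1, 0), (2, 1, 0), (2, 1, 1), (3, 1, 0), (3, 1, 1), (4, 1, 0), (4, 1, 1),
    (5, 0, 1), (5, 1, 1), (6, 0, 0), (6, 0, 1), (7, 0, 0), (7, 0, 1)}
    (by decide) (by decide)
    {(0, 0, 0), (0, 1, 0), (2, 0, 1), (2, 1, 1)}
    (by decide) (by decide)

set_option synthInstance.maxSize 4096 in
/-- **`x² = r⁴ t`** (`Gal(K/ℚ) ≅ C₈ ⋊₋₁ C₄ = ⟨r⟩ ⋊ ⟨x⟩` again, `c = r⁴`): a simple DEGENERATE CM abelian `16`-fold (primitive CM set of rank `13 < 17`, balanced set of size `4`, by `decide`). [cite: Shimura1998, §6.2 Thm. 3 and §8.2 Prop. 26] [cite: Gordon1999HodgeAVSurvey, Thm. 6.4 and §9.3] -/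
theorem exists_simple_degenerate_inverting_sq_r4t (hdeg : Module.finrank ℚ K = 32) (r t x : K ≃ₐ[ℚ] K)
    (hr : orderOf r = 8) (htt : t * t = 1) (htr : t ∉ Subgroup.zpowers r) (hrt : r * t = t * r)
    (hxr : x * r = r⁻¹ * x) (hxt : x * t = t * x) (hxA : ∀ i j : ℕ, r ^ i * t ^ j * x ≠ 1)
    (hc : (IsCMField.complexConj K).restrictScalars ℚ = r ^ 4)
    (hxx : x * x = r ^ 4 * t) :
    ∃ (Φ : CMType K) (φ : K →+* ℂ) (X : AbelianVariety ℂ) (ι : 𝓞 K →+* End X)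
      (ϑ : K →+* Module.End ℂ (complexBetti X.X 1)),
      IsPrimitive (ℂ ≃+* ℂ) Φ.1 φ ∧ ¬ IsNondegenerate Φ ∧ IsCMTypeRealisation Φ X ι ϑ ∧ X.IsSimple ∧ X.dim = 16 ∧
      ∃ m p : ℕ, ∃ z : complexBetti (⨁ fun _ : Fin m => X).X (2 * p), IsRationalClass z ∧
        IsOfHodgeType (⨁ fun _ : Fin m => X).dim (⨁ fun _ : Fin m => X).X (2 * p) p p z ∧
        z ∉ divisorClassesSpan (⨁ fun _ : Fin m => X).X (⨁ fun _ : Fin m => X).dim p :=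
  exists_simple_degenerate_of_inverted_table hdeg r t x hr htt htr hrt hxr hxt hxA hc 4 1
    (by rw [show ((4 : ZMod 8)).val = 4 from rfl, show ((1 : ZMod 2)).val = 1 from rfl, pow_one]; exact hxx)
    (fun p q : ZMod 8 × ZMod 2 × ZMod 2 =>
      (p.1 + (if p.2.2 = 0 then q.1 else 7 * q.1) + (if p.2.2 = 1 ∧ q.2.2 = 1 then 4 else 0),
        p.2.1 + q.2.1 + (if p.2.2 = 1 ∧ q.2.2 = 1 then 1 else 0), p.2.2 + q.2.2))
    (fun _ _ => rfl) (by decide) (by decide)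
    {(0, 1, 0), (1, 0, 1), (1, 1, 0), (2, 0, 1), (2, 1, 0), (3, 0, 1), (4, 0, 0), (4, 0, 1), (4, 1, 1), (5, 0, 0),
    (5, 1, 1), (6, 0, 0), (6, 1, 1), (7, 0, 0), (7, 1, 0), (7, 1, 1)}
    (by decide) (by decide)
    {(0, 0, 0), (3, 0, 1), (4, 1, 0), (7, 1, 1)}
    (by decide) (by decide)

/-! ## §2 The structured leaf `Q₁₆ × C₂` -/

set_option synthInstance.maxSize 4096 in
/-- **`x² = r⁴`** (`Gal(K/ℚ) = ⟨r, x⟩ × ⟨t⟩ ≅ Q₁₆ × C₂`, `c = r⁴ ∈ Q₁₆`): STRUCT — `H = {g : (e g)₂ = 0} ≃ Q₁₆` is a complement of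
`E = ⟨t⟩` containing `c`. [cite: Rotman1995, Thm. 5.46] -/
theorem struct_of_inverting_sq_r4 (hdeg : Module.finrank ℚ K = 32) (r t x : K ≃ₐ[ℚ] K)
    (hr : orderOf r = 8) (htt : t * t = 1) (htr : t ∉ Subgroup.zpowers r) (hrt : r * t = t * r)
    (hxr : x * r = r⁻¹ * x) (hxt : x * t = t * x) (hxA : ∀ i j : ℕ, r ^ i * t ^ j * x ≠ 1)
    (hc : (IsCMField.complexConj K).restrictScalars ℚ = r ^ 4)
    (hxx : x * x = r ^ 4) (htcen : ∀ g : K ≃ₐ[ℚ] K, g * t = t * g) :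
    ∃ (H E : Subgroup (K ≃ₐ[ℚ] K)) (k : ℕ), H.IsComplement' E ∧ (IsCMField.complexConj K).restrictScalars ℚ ∈ H ∧
      (IsCMField.complexConj K).restrictScalars ℚ ∉ E ∧ (∀ e ∈ E, e * e = 1 ∧ ∀ g : K ≃ₐ[ℚ] K, g * e = e * g) ∧
      Nat.card E ≤ 2 ∧ Nat.card H = 2 ^ k ∧ (IsCyclic H ∨ (3 ≤ k ∧ Nonempty (H ≃* QuaternionGroup (2 ^ (k - 2))))) := by
  classical
  set c := (IsCMField.complexConj K).restrictScalars ℚ with hcdef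
  have hcard : Nat.card (K ≃ₐ[ℚ] K) = 32 := by
    rw [Nat.card_eq_fintype_card, card_model_eq_finrank (MulEquiv.refl (K ≃ₐ[ℚ] K)), hdeg]
  have ht1 : t ≠ 1 := fun h => htr (by rw [h]; exact (Subgroup.zpowers r).one_mem)
  have hr8 : r ^ 8 = 1 := by rw [← hr]; exact pow_orderOf_eq_one r
  have hr4ne : r ^ 4 ≠ 1 := fun h => by
    have := orderOf_dvd_of_pow_eq_one h; rw [hr] at this; omega
  obtain ⟨e, he, her, het, hex, he1, -⟩ := exists_table_inverted hcard hr htt htr hrt hxr hxt 4 0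
    (by rw [show ((4 : ZMod 8)).val = 4 from rfl, show ((0 : ZMod 2)).val = 0 from rfl, pow_zero, mul_one]; exact hxx) hxA
    (fun p q : ZMod 8 × ZMod 2 × ZMod 2 =>
      (p.1 + (if p.2.2 = 0 then q.1 else 7 * q.1) + (if p.2.2 = 1 ∧ q.2.2 = 1 then 4 else 0),
        p.2.1 + q.2.1 + (if p.2.2 = 1 ∧ q.2.2 = 1 then 0 else 0), p.2.2 + q.2.2))
    (fun _ _ => rfl) (by decide) (by decide)
  -- the subgroup `H = {g : (e g).2.1 = 0}`
  have hmul2 : ∀ g h : K ≃ₐ[ℚ] K, (e (g * h)).2.1 = (e g).2.1 + (e h).2.1 := by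
    intro g h; rw [he]; simp only; split_ifs <;> simp
  let H : Subgroup (K ≃ₐ[ℚ] K) :=
    { carrier := {g | (e g).2.1 = 0}
      mul_mem' := fun {g h} hg hh => by
        simp only [Set.mem_setOf_eq] at hg hh ⊢
        rw [hmul2, hg, hh, add_zero]
      one_mem' := by simp only [Set.mem_setOf_eq, he1]
      inv_mem' := fun {g} hg => by
        simp only [Set.mem_setOf_eq] at hg ⊢
        have h1 := hmul2 g g⁻¹
        rw [mul_inv_cancel, he1, hg, zero_add] at h1
        exact h1.symm }
  have hmemH : ∀ g, g ∈ H ↔ (e g).2.1 = 0 := fun g => Iff.rfl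
  have hrH : r ∈ H := by rw [hmemH, her]
  have hxH : x ∈ H := by rw [hmemH, hex]
  have htH : t ∉ H := by rw [hmemH, het]; decide
  have hcH : c ∈ H := by rw [hc]; exact H.pow_mem hrH 4
  -- `|H| = 16`
  have hHcard : Nat.card H = 16 := by
    have h1 : Nat.card H = Nat.card {p : ZMod 8 × ZMod 2 × ZMod 2 // p.2.1 = 0} :=
      Nat.card_congr (e.subtypeEquiv fun g => hmemH g)
    rw [h1, Nat.card_eq_fintype_card]
    rfl
  -- `E = ⟨t⟩`
  set E := Subgroup.zpowers t with hE
  have hmemE : ∀ σ : K ≃ₐ[ℚ] K, σ ∈ E ↔ σ = 1 ∨ σ = t := fun σ => by rw [hE]; exact mem_zpowers_iff_of_mul_self_eq_one htt σ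
  have hEcard : Nat.card E = 2 := card_zpowers_of_mul_self_eq_one htt ht1
  have hdisj : Disjoint H E := by
    rw [disjoint_iff, eq_bot_iff]
    intro g hg
    rw [Subgroup.mem_inf] at hg
    rcases (hmemE g).1 hg.2 with h | h
    · rw [h]; exact Subgroup.mem_bot.2 rfl
    · exact absurd (h ▸ hg.1) htH
  have hHE : H.IsComplement' E := Subgroup.isComplement'_of_card_mul_and_disjoint (by rw [hHcard, hEcard, hcard]) hdisj
  -- `H ≃* Q₁₆`
  have hrH8 : orderOf (⟨r, hrH⟩ : H) = 2 * 4 := by rw [Subgroup.orderOf_mk]; rw [hr]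
  have hxzp : (⟨x, hxH⟩ : H) ∉ Subgroup.zpowers (⟨r, hrH⟩ : H) := by
    intro h
    obtain ⟨i, hi⟩ := Subgroup.mem_zpowers_iff.1 h
    have hi' : r ^ i = x := by
      have := congrArg Subtype.val hi
      simpa using this
    -- `x ∈ ⟨r⟩` commutes with `r`, but `x r = r⁻¹ x` and `r² ≠ 1`
    have hcomm : x * r = r * x := by rw [← hi']; exact ((Commute.refl r).zpow_left i).eq
    rw [hxr] at hcomm
    have h2 : r⁻¹ = r := mul_right_cancel hcomm
    apply hr4ne
    have h3 : r * r = 1 := by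
      calc r * r = r⁻¹ * r := by rw [h2]
        _ = 1 := inv_mul_cancel r
    rw [show r ^ 4 = (r * r) * (r * r) by simp only [pow_succ, pow_zero, one_mul, mul_assoc], h3, one_mul]
  have hquat : Nonempty (H ≃* QuaternionGroup 4) :=
    nonempty_mulEquiv_quaternionGroup_of_relations (n := 4) (a := ⟨r, hrH⟩) (x := ⟨x, hxH⟩) (by rw [hHcard]) hrH8 hxzp
      (Subtype.ext (by simpa using (show x * r * x⁻¹ = r⁻¹ by rw [hxr, mul_inv_cancel_right])))
      (Subtype.ext (by simpa using hxx))
  refine ⟨H, E, 4, hHE, hcH, ?_, ?_, by rw [hEcard], by rw [hHcard]; norm_num, Or.inr ⟨by norm_num, ?_⟩⟩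
  · intro h
    rcases (hmemE c).1 h with h' | h'
    · exact hr4ne (hc ▸ h')
    · exact htH (h' ▸ hcH)
  · intro g hg
    rcases (hmemE g).1 hg with h' | h' <;> rw [h']
    · exact ⟨mul_one 1, fun g => by rw [mul_one, one_mul]⟩
    · exact ⟨htt, htcen⟩
  · simpa using hquat

end Summit.HodgeConjecture.CorCM.GaloisModels

end
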